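import Summits.BirchSwinnertonDyer.BirchSwinnertonDyer.Theorems.PrintCFramBottomClassIndexLawFiveLeHeegnerFieldSupplySeedOn
import Summits.BirchSwinnertonDyer.BirchSwinnertonDyer.Theorems.PrintCFramBottomClassIndexLawFiveLeHeegnerFieldSupplyAtPRung
import HarnessLib

/-!
# Crux `PrintCFram.BottomClassIndexLawFiveLe` (stmt-BirchSwinnertonDyer-20372), line `eisenstein-resource-bdp-line` (registry v20 → v21):
# THE RAMIFIED TWIST SEED — the analytic residue `(SeedII⁶)` (= registry v21's `stub_seedOff`) follows from ONE Eisenstein-REGULAR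
# `p`-ramified real-twist partner of the class, i.e. it is a statement in CLASS-FACTOR currency
# (cell `bsd-print-cfram`, width seat `bsd-line-cfram-p1-w3` g11; THEOREMS ONLY, `--supports` 20372; BSD is not proved by any of this)

HONEST FRAMING. Nothing here is a statement about BSD; Stub C is not proved; `(SeedII⁶)` is not proved — it is REDUCED. LEAD g12's
`…HeegnerFieldSupplyAtPRung` (p681058) split w8 g4's six-prime supply statement `(P⁶)` as `(P⁶) ⟸ (AtP⁶) ∧ (Seed⁶)` and
`(Seed⁶) ⟸ (SeedI⁶) ∧ (SeedII⁶)` along the locus `L(m,p)` = «every prime of `m` splits in `K = ℚ(√−p)`»; w8 g5's `seedOn_six`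
(p681991) proved `(SeedI⁶)`: ON the locus the seed field is the CM field `K₀ = ℚ(√−p)` itself, whose field factor IS the class factor.
This file proves the same mechanism for EVERY `p`-RAMIFIED imaginary quadratic field `K₀ = ℚ(√−ps)`, `s ≡ 1 (mod 4)` squarefree,
`s ⊥ p` (LEAD g12 crux notes §3.2 «the twisted seed», w8 g5 notes v3 §4, both prose only until now):

  `seed_of_ramifiedTwist`: for the class datum `(p, m, χ, k)` (`p ≡ 3 (mod 4)`, `p ≥ 7`, `χ` primitive mod `m ⊥ p`,
  `k ∈ {(p+1)/4, (3p−1)/4}`) — NO locus hypothesis, NO regularity hypothesis on the class itself — and ANY such `s` with every prime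
  `q ∣ m` split in `K₀` («`J(−ps | q) = 1` for odd `q ∣ m`; `2 ∣ m ⟹ ps ≡ 7 (mod 8)`») and a character `χ'` mod `m·s` with the values
  `χ'(a) = χ(a)·J(a | s)` (the quadratic character of the REAL-TWIST PARTNER class `e·s`; it exists, `exists_twistChar`) whose
  TWISTED CLASS FACTOR is a unit, `¬ ‖(p−k)⁻¹ B_{p−k,χ'}‖ ≤ p⁻¹`: the `(Seed⁶)` conclusion holds — witness `K₀` (discriminant `−ps`,
  odd, `< −4`), `ε₀ = J(· | ps)` its Kronecker character, every `q ∣ m` split, and UNIT field factor `¬ ‖k⁻¹ B_{k,(χ↑ε₀↑)~}‖ ≤ p⁻¹`,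
  because `(χ↑ε₀↑)~` has the values of `χ'↑(ω^{(p−1)/2})↑` (`J(a | ps) = J(a | s)·J(a | p)`, `J(a | p) = ω(a)^{(p−1)/2}` in `ℚ_p`)
  and w8 g5's CM reflection `(1/k)B_{k,χ'·(·/p)} ≡ (1/(p−k))B_{p−k,χ'} (mod p)` (`norm_div_generalizedBernoulli_legendreTwist_le_inv_iff`,
  p680812) applies to `χ'` (level `ms ⊥ p`). In Cohen–Eisenstein terms: the coefficient `H(k, m·p·s)` of the weight-`(k+1/2)` series at
  the `K`-RAMIFIED index `m·p·s` is the class factor `H(p−k, m·s)` of the twisted class. `s = 1` is `seedOn_six`.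

CONSEQUENCES (pure logic on top): `seedOff_six_of_twistRegular` — LEAD's `hOff` = `(SeedII⁶)` = registry v21's `stub_seedOff` VERBATIM
⟸ **(TwistReg⁶)** := «every class datum OFF the locus with unit class factor has such a pair `(s, χ')`»; `seed_six_of_twistRegular` —
`(Seed⁶)` ⟸ the same statement without the locus clause; `stubC_of_atP_of_twistRegular` — Stub C VERBATIM ⟸ (AtP⁶) ∧ (TwistReg⁶)
(LEAD's `stubC_of_atP_of_seedOn_of_seedOff` fed with `seedOn_six`). READING for the planner: after v21 the analytic residue of the line
admits a sufficient condition in the SAME currency as B1's locus — generalized Bernoulli numbers `B_{p−k,χ'}` of quadratic characters of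
conductor prime to `p` —: «the Eisenstein-IRREGULAR (B1-type) classes omit at least one member of the `K₀`-split real-twist progression
`{e·s : s ≡ 1 (4) squarefree ⊥ p, (s | q) = (−p | q) ∀ q ∣ m}` of every class `e`». No Legendre condition at `p`, no field factor, no
half-integral weight form. Not claimed proved (a horizontal non-vanishing mod `p`); plausibly true (B1-type classes are sparse: 2/65 on the
cell's window). beyond-print theorem: NO.

References: [Washington1997] Thm. 5.11, Cor. 5.13, §5.1; [Cox2013] §1.C Lemma 1.14; [Marcus2018] Ch. 3 Thm. 25; [IrelandRosen1990]
Prop. 5.1.2; [KrizLi2019] Thm. 1.20, §8; [Cohen1975] Thm. 3.1 (`H(r,N)`); [AhlgrenBoylan2003] Thm. 3 (the at-`p` rung's print, LEAD's file).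
-/

set_option autoImplicit false
-- summit-side namespace `Summit.BirchSwinnertonDyer.BirchSwinnertonDyer.…` (single-conjunct summit, D-0017 layout)
set_option linter.dupNamespace false

noncomputable section

open scoped Classical NumberTheorySymbols
open NumberField WeierstrassCurve DirichletCharacter Literature.NumberTheory.LFunctions
  Literature.NumberTheory.EllipticCurves Literature.NumberTheory.EllipticCurves.KrizLi2019
  Literature.NumberTheory.EllipticCurves.Rank1Residual Literature.NumberTheory.Congruences
  Literature.NumberTheory.QuadraticFields

namespace Summit.BirchSwinnertonDyer.BirchSwinnertonDyer.Theorems.PrintCFram.HeegnerFieldSupply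

open Summit.BirchSwinnertonDyer.BirchSwinnertonDyer.Theorems.PrintCFram
open Summit.BirchSwinnertonDyer.BirchSwinnertonDyer.Theorems.PrintCFram.KummerDictionary
open Summit.BirchSwinnertonDyer.Rank1Residual Summit.BirchSwinnertonDyer.Rank1Residual.X12.O11

variable {p : ℕ} [hp : Fact p.Prime]

/-! ## §1 The quadratic character of the real-twist partner: `a ↦ χ(a)·J(a | s)` at level `m·s` -/

/-- **The twisted character exists**: for any `χ` mod `m` and any `s ≥ 1` there is a Dirichlet character `χ'` mod `m·s` (valued in
`ℚ_p`) with `χ'(a) = χ(a)·J(a | s)` for every `a ∈ ℕ` — the product of `χ` and the Jacobi character mod `s`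
(`KrizLiBinders.exists_jacobiCharPadic`) at the common level. For `s ≡ 1 (mod 4)` squarefree, `J(· | s)` is the Kronecker character of
`ℚ(√s)` and `χ'` is the quadratic character of the real-twist partner class `e·s`. [cite: Cox2013, §1.C Lemma 1.14] -/
theorem exists_twistChar {m : ℕ} [NeZero m] (χ : DirichletCharacter ℚ_[p] m) (s : ℕ) [NeZero s] :
    ∃ χ' : DirichletCharacter ℚ_[p] (m * s),
      ∀ a : ℕ, χ' (a : ZMod (m * s)) = χ (a : ZMod m) * (J((a : ℤ) | s) : ℚ_[p]) := by
  obtain ⟨κ, hκ⟩ := KrizLiBinders.exists_jacobiCharPadic (p := p) s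
  refine ⟨changeLevel (dvd_mul_right m s) χ * changeLevel (dvd_mul_left s m) κ, fun a => ?_⟩
  rw [CharacterTwist.changeLevel_mul_changeLevel_apply_natCast, hκ a]

/-! ## §2 The ramified twist seed (pointwise, minimal hypotheses) -/

/-- **THE RAMIFIED TWIST SEED.** Let `p ≡ 3 (mod 4)`, `p ≥ 7`, `χ` a PRIMITIVE character mod `m ⊥ p` (valued in `ℚ_p`),
`k ∈ {(p+1)/4, (3p−1)/4}`; let `s ≡ 1 (mod 4)` be squarefree with `s ⊥ p`, such that every prime `q ∣ m` splits in `K₀ = ℚ(√−ps)`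
(`J(−ps | q) = 1` for odd `q`, `ps ≡ 7 (mod 8)` if `2 ∣ m`), and let `χ'` mod `m·s` have the values `χ(a)·J(a | s)`. If the TWISTED
CLASS FACTOR is a unit, `¬ ‖(p−k)⁻¹ B_{p−k,χ'}‖_p ≤ p⁻¹`, then there is an imaginary quadratic field `K₀` (namely `d_{K₀} = −ps`: odd,
`< −4`) with Kronecker character `ε₀`, every prime of `m` split in `K₀`, and UNIT field factor `¬ ‖k⁻¹ B_{k,(χ↑ε₀↑)~}‖_p ≤ p⁻¹` — the
conclusion of LEAD g12's `(Seed⁶)`. Mechanism: `ε₀ = J(· | ps)` (`KrizLiBinders.exists_isKroneckerCharacterOf_of_discr`), so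
`(χ↑ε₀↑)` (primitive, conductor `m·ps`) takes the values `χ(a)J(a|s)·J(a|p) = χ'(a)·ω(a)^{(p−1)/2}` of `χ'↑(ω^{(p−1)/2})↑`; equal values
and (propositionally) equal levels give equal generalized Bernoulli numbers; then w8 g5's CM reflection at `χ'` (level `ms ⊥ p`).
`s = 1` is `seedOn_six`. [cite: Washington1997, Thm. 5.11 and Cor. 5.13] [cite: Cox2013, §1.C Lemma 1.14] [cite: Marcus2018, Ch. 3 Thm. 25]
[cite: IrelandRosen1990, Prop. 5.1.2] -/
theorem seed_of_ramifiedTwist (hp3 : p % 4 = 3) (h7 : 7 ≤ p) {m : ℕ} [NeZero m] (hmp : m.Coprime p)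
    (χ : DirichletCharacter ℚ_[p] m) (hχ : χ.IsPrimitive) {k : ℕ} (hk : k = (p + 1) / 4 ∨ k = (3 * p - 1) / 4)
    {s : ℕ} [NeZero s] (hs4 : s % 4 = 1) (hsq : Squarefree s) (hsp : s.Coprime p)
    (hsplit : (∀ q : ℕ, q.Prime → q ∣ m → q ≠ 2 → jacobiSym (-((p * s : ℕ) : ℤ)) q = 1) ∧ (2 ∣ m → (p * s) % 8 = 7))
    (χ' : DirichletCharacter ℚ_[p] (m * s))
    (hχ' : ∀ a : ℕ, χ' (a : ZMod (m * s)) = χ (a : ZMod m) * (J((a : ℤ) | s) : ℚ_[p]))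
    (hunit : ¬ ‖((p - k : ℕ) : ℚ_[p])⁻¹ * generalizedBernoulli (p - k) χ'‖ ≤ (p : ℝ)⁻¹) :
    ∃ (K₀ : Type) (_ : Field K₀) (_ : NumberField K₀) (ε₀ : DirichletCharacter ℚ_[p] (NumberField.discr K₀).natAbs),
      IsImaginaryQuadratic K₀ ∧
      (∀ q : ℕ, q.Prime → q ∣ m → ((Ideal.span {(q : ℤ)}).primesOver (𝓞 K₀)).ncard = 2) ∧
      Odd (NumberField.discr K₀) ∧ NumberField.discr K₀ < -4 ∧ IsKroneckerCharacterOf K₀ ε₀ ∧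
      ¬ ‖(k : ℚ_[p])⁻¹ * @generalizedBernoulli ℚ_[p] _ _
          (changeLevel (dvd_mul_right m (NumberField.discr K₀).natAbs) χ *
            changeLevel (dvd_mul_left (NumberField.discr K₀).natAbs m) ε₀).conductor ⟨conductor_ne_zero _⟩ k
          (changeLevel (dvd_mul_right m (NumberField.discr K₀).natAbs) χ *
            changeLevel (dvd_mul_left (NumberField.discr K₀).natAbs m) ε₀).primitiveCharacter‖ ≤ (p : ℝ)⁻¹ := by
  have hpp := hp.out
  have hp2 : p ≠ 2 := by omega
  have hs0 : s ≠ 0 := NeZero.ne s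
  have hs1 : 1 ≤ s := Nat.one_le_iff_ne_zero.mpr hs0
  -- arithmetic of `p·s`
  have hps3 : (p * s) % 4 = 3 := by
    rw [Nat.mul_mod, hp3, hs4]
  have hps7 : 7 ≤ p * s := le_trans h7 (Nat.le_mul_of_pos_right p hs1)
  have hpsq : Squarefree (p * s) := Nat.squarefree_mul_iff.mpr ⟨hsp.symm, hpp.squarefree, hsq⟩
  -- `m ⊥ s`: a common prime `q` would ramify in `K₀`, contradicting the splitting hypothesis
  have hms : m.Coprime s := by
    refine Nat.coprime_of_dvd fun q hq hqm hqs => ?_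
    by_cases hq2 : q = 2
    · subst hq2
      omega
    · have hJ := hsplit.1 q hq hqm hq2
      have hdvd : (q : ℤ) ∣ -((p * s : ℕ) : ℤ) :=
        (Int.natCast_dvd_natCast.mpr (Dvd.dvd.mul_left hqs p)).neg_right
      rw [jacobiSym.mod_left, Int.emod_eq_zero_of_dvd hdvd, jacobiSym.zero_left hq.one_lt] at hJ
      exact zero_ne_one hJ
  have hmps : m.Coprime (p * s) := Nat.Coprime.mul_right hmp hms
  have hmsp : (m * s).Coprime p := Nat.Coprime.mul_left hmp hsp
  -- the field `K₀ = ℚ(√−ps)`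
  have hsqZ : Squarefree (-((p * s : ℕ) : ℤ)) := by
    rw [← Int.squarefree_natAbs, Int.natAbs_neg, Int.natAbs_natCast]
    exact hpsq
  obtain ⟨K₀, iF, iN, h2, hd⟩ := Quadratic.exists_numberField_discr_eq (D := -((p * s : ℕ) : ℤ))
    (Or.inl ⟨by omega, hsqZ, by omega⟩)
  have hK₀ : IsImaginaryQuadratic K₀ := isImaginaryQuadratic_of_discr_eq_of_neg h2 hd (by omega)
  have hdn : (NumberField.discr K₀).natAbs = p * s := by rw [hd, Int.natAbs_neg, Int.natAbs_natCast]
  -- its Kronecker character `J(· | ps)` and a Teichmüller character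
  obtain ⟨ε₀, hε₀, hε₀v⟩ :=
    KrizLiBinders.exists_isKroneckerCharacterOf_of_discr (p := p) h2 (m := p * s) hpsq (Or.inr ⟨hd, hps3⟩)
  obtain ⟨ω, hω⟩ := exists_isTeichmullerCharacter (p := p)
  have hh : (p - 1) / 2 ≠ 0 := by omega
  refine ⟨K₀, iF, iN, ε₀, hK₀, ?_, ?_, ?_, hε₀, ?_⟩
  · -- every prime of `m` splits in `K₀`
    intro q hq hqm
    by_cases hq2 : q = 2
    · subst hq2
      have h8 : NumberField.discr K₀ % 8 = 1 := by
        rw [hd]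
        have := hsplit.2 hqm
        omega
      have h := (Quadratic.ncard_primesOver_two_eq_two_iff h2).mpr h8
      simpa using h
    · rw [Quadratic.ncard_primesOver_eq_two_iff_jacobiSym h2 hq hq2, hd]
      exact hsplit.1 q hq hqm hq2
  · rw [hd, Int.odd_iff]
    omega
  · rw [hd]
    omega
  · -- the field factor at `K₀` is the reflected TWISTED class factor
    set Ψ : DirichletCharacter ℚ_[p] (m * (NumberField.discr K₀).natAbs) :=
      changeLevel (dvd_mul_right m (NumberField.discr K₀).natAbs) χ *
        changeLevel (dvd_mul_left (NumberField.discr K₀).natAbs m) ε₀ with hΨ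
    have hcχ : χ.conductor = m := hχ
    have hcε : ε₀.conductor = (NumberField.discr K₀).natAbs := hε₀.1
    have hcond : Ψ.conductor = m * s * p := by
      rw [hΨ, RouteU.conductor_changeLevel_mul_changeLevel _ _ χ ε₀ (by rw [hcχ, hcε, hdn]; exact hmps),
        hcχ, hcε, hdn]
      ring
    have hΨprim : Ψ.IsPrimitive := by
      rw [isPrimitive_def, hcond, hdn]
      ring
    have hval : ∀ a : ℕ, Ψ.primitiveCharacter (a : ZMod Ψ.conductor) =
        (changeLevel (dvd_mul_right (m * s) p) χ' * changeLevel (dvd_mul_left p (m * s)) (ω ^ ((p - 1) / 2)) :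
          DirichletCharacter ℚ_[p] (m * s * p)) (a : ZMod (m * s * p)) := by
      intro a
      rw [primitiveCharacter_apply_natCast_of_isPrimitive Ψ hΨprim a, hΨ,
        CharacterTwist.changeLevel_mul_changeLevel_apply_natCast χ ε₀ a, thetaShape_apply_natCast χ' ω hh a,
        hε₀v a, hχ' a, ← jacobiSym_eq_teichmuller_pow_half hω hp2 a, jacobiSym.mul_right, Int.cast_mul]
      ring
    have hB : @generalizedBernoulli ℚ_[p] _ _ Ψ.conductor ⟨conductor_ne_zero _⟩ k Ψ.primitiveCharacter =
        generalizedBernoulli k (changeLevel (dvd_mul_right (m * s) p) χ' *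
          changeLevel (dvd_mul_left p (m * s)) (ω ^ ((p - 1) / 2))) := by
      haveI : NeZero Ψ.conductor := ⟨conductor_ne_zero _⟩
      exact generalizedBernoulli_eq_of_forall_apply_natCast_eq hcond _ _ hval k
    intro hle
    apply hunit
    rw [hB] at hle
    exact (norm_div_generalizedBernoulli_legendreTwist_le_inv_iff hp3 h7 hmsp χ' hω hk).mp hle

/-! ## §3 On the six-prime binders: `(SeedII⁶)` VERBATIM ⟸ (TwistReg⁶), and `(Seed⁶)` ⟸ the locus-free form -/

/-- **`(SeedII⁶)` ⟸ (TwistReg⁶).** LEAD g12's hypothesis `hOff` of `seed_six_of_seedOn_of_seedOff` / `stubC_of_atP_of_seedOn_of_seedOff`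
(p681058) — the seed OFF the locus `L(m,p)`, registry v21's `stub_seedOff`, VERBATIM — follows from **(TwistReg⁶)**: for every class datum
`(p, m, χ, k)` at the six leaf primes which is OFF the locus and has a UNIT class factor, SOME `s ≡ 1 (mod 4)` squarefree with `s ⊥ p`
and every prime of `m` split in `ℚ(√−ps)` carries a twisted character `χ' = χ·J(· | s)` mod `m·s` with UNIT twisted class factor
`¬ ‖(p−k)⁻¹ B_{p−k,χ'}‖ ≤ p⁻¹` (an Eisenstein-REGULAR real-twist partner in the `K₀`-split progression). Pointwise `seed_of_ramifiedTwist`.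
[cite: Washington1997, Thm. 5.11 and Cor. 5.13] [cite: KrizLi2019, Thm. 1.20 (p. 8) and §8 (pp. 49–52)] -/
theorem seedOff_six_of_twistRegular
    (hTw : ∀ (p : ℕ) [Fact p.Prime] (m : ℕ) [NeZero m] (χ : DirichletCharacter ℚ_[p] m) (k : ℕ),
      (p = 7 ∨ p = 11 ∨ p = 19 ∨ p = 43 ∨ p = 67 ∨ p = 163) →
      m.Coprime p → χ.IsPrimitive → χ.IsQuadratic → (k = (p + 1) / 4 ∨ k = (3 * p - 1) / 4) →
      2 ≤ k → k ≤ p - 2 → χ (-1) * (-1) ^ k = -1 →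
      ¬ ((∀ q : ℕ, q.Prime → q ∣ m → q ≠ 2 → jacobiSym (-(p : ℤ)) q = 1) ∧ (2 ∣ m → p % 8 = 7)) →
      ¬ ‖((p - k : ℕ) : ℚ_[p])⁻¹ * generalizedBernoulli (p - k) χ‖ ≤ (p : ℝ)⁻¹ →
      ∃ (s : ℕ) (_ : NeZero s) (χ' : DirichletCharacter ℚ_[p] (m * s)),
        s % 4 = 1 ∧ Squarefree s ∧ s.Coprime p ∧
        ((∀ q : ℕ, q.Prime → q ∣ m → q ≠ 2 → jacobiSym (-((p * s : ℕ) : ℤ)) q = 1) ∧ (2 ∣ m → (p * s) % 8 = 7)) ∧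
        (∀ a : ℕ, χ' (a : ZMod (m * s)) = χ (a : ZMod m) * (J((a : ℤ) | s) : ℚ_[p])) ∧
        ¬ ‖((p - k : ℕ) : ℚ_[p])⁻¹ * generalizedBernoulli (p - k) χ'‖ ≤ (p : ℝ)⁻¹) :
    ∀ (p : ℕ) [Fact p.Prime] (m : ℕ) [NeZero m] (χ : DirichletCharacter ℚ_[p] m) (k : ℕ),
      (p = 7 ∨ p = 11 ∨ p = 19 ∨ p = 43 ∨ p = 67 ∨ p = 163) →
      m.Coprime p → χ.IsPrimitive → χ.IsQuadratic → (k = (p + 1) / 4 ∨ k = (3 * p - 1) / 4) →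
      2 ≤ k → k ≤ p - 2 → χ (-1) * (-1) ^ k = -1 →
      ¬ ((∀ q : ℕ, q.Prime → q ∣ m → q ≠ 2 → jacobiSym (-(p : ℤ)) q = 1) ∧ (2 ∣ m → p % 8 = 7)) →
      ¬ ‖((p - k : ℕ) : ℚ_[p])⁻¹ * generalizedBernoulli (p - k) χ‖ ≤ (p : ℝ)⁻¹ →
      ∃ (K₀ : Type) (_ : Field K₀) (_ : NumberField K₀) (ε₀ : DirichletCharacter ℚ_[p] (NumberField.discr K₀).natAbs),
        IsImaginaryQuadratic K₀ ∧
        (∀ q : ℕ, q.Prime → q ∣ m → ((Ideal.span {(q : ℤ)}).primesOver (𝓞 K₀)).ncard = 2) ∧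
        Odd (NumberField.discr K₀) ∧ NumberField.discr K₀ < -4 ∧ IsKroneckerCharacterOf K₀ ε₀ ∧
        ¬ ‖(k : ℚ_[p])⁻¹ * @generalizedBernoulli ℚ_[p] _ _
            (changeLevel (dvd_mul_right m (NumberField.discr K₀).natAbs) χ *
              changeLevel (dvd_mul_left (NumberField.discr K₀).natAbs m) ε₀).conductor ⟨conductor_ne_zero _⟩ k
            (changeLevel (dvd_mul_right m (NumberField.discr K₀).natAbs) χ *
              changeLevel (dvd_mul_left (NumberField.discr K₀).natAbs m) ε₀).primitiveCharacter‖ ≤ (p : ℝ)⁻¹ := by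
  intro p hpF m _ χ k hp6 hmp hχ hχq hk hk2 hkp hpar hL hcls
  obtain ⟨s, hsne, χ', hs4, hsq, hsp, hsplit, hχ', hunit⟩ := hTw p m χ k hp6 hmp hχ hχq hk hk2 hkp hpar hL hcls
  haveI := hsne
  have hp3 : p % 4 = 3 := by rcases hp6 with h | h | h | h | h | h <;> subst h <;> norm_num
  have h7 : 7 ≤ p := by rcases hp6 with h | h | h | h | h | h <;> omega
  exact seed_of_ramifiedTwist hp3 h7 hmp χ hχ hk hs4 hsq hsp hsplit χ' hχ' hunit

/-- **`(Seed⁶)` ⟸ the locus-free (TwistReg⁶).** LEAD g12's hypothesis `hSeed` of `splitPrimes_bernoulliUnit_six_of_atP_of_seed` (p681058)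
— a seed in the `m`-cut for every REGULAR class datum, on or off the locus — follows from the locus-free form of (TwistReg⁶). (ON the
locus `s = 1`, `χ' = χ` is a witness by the class's own regularity — that is `seedOn_six`; the point of this form is that a proof of the
twisted-regular statement need not case on the locus.) [cite: Washington1997, Thm. 5.11 and Cor. 5.13] [cite: KrizLi2019, §8 (pp. 49–52)] -/
theorem seed_six_of_twistRegular
    (hTw : ∀ (p : ℕ) [Fact p.Prime] (m : ℕ) [NeZero m] (χ : DirichletCharacter ℚ_[p] m) (k : ℕ),
      (p = 7 ∨ p = 11 ∨ p = 19 ∨ p = 43 ∨ p = 67 ∨ p = 163) →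
      m.Coprime p → χ.IsPrimitive → χ.IsQuadratic → (k = (p + 1) / 4 ∨ k = (3 * p - 1) / 4) →
      2 ≤ k → k ≤ p - 2 → χ (-1) * (-1) ^ k = -1 →
      ¬ ‖((p - k : ℕ) : ℚ_[p])⁻¹ * generalizedBernoulli (p - k) χ‖ ≤ (p : ℝ)⁻¹ →
      ∃ (s : ℕ) (_ : NeZero s) (χ' : DirichletCharacter ℚ_[p] (m * s)),
        s % 4 = 1 ∧ Squarefree s ∧ s.Coprime p ∧
        ((∀ q : ℕ, q.Prime → q ∣ m → q ≠ 2 → jacobiSym (-((p * s : ℕ) : ℤ)) q = 1) ∧ (2 ∣ m → (p * s) % 8 = 7)) ∧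
        (∀ a : ℕ, χ' (a : ZMod (m * s)) = χ (a : ZMod m) * (J((a : ℤ) | s) : ℚ_[p])) ∧
        ¬ ‖((p - k : ℕ) : ℚ_[p])⁻¹ * generalizedBernoulli (p - k) χ'‖ ≤ (p : ℝ)⁻¹) :
    ∀ (p : ℕ) [Fact p.Prime] (m : ℕ) [NeZero m] (χ : DirichletCharacter ℚ_[p] m) (k : ℕ),
      (p = 7 ∨ p = 11 ∨ p = 19 ∨ p = 43 ∨ p = 67 ∨ p = 163) →
      m.Coprime p → χ.IsPrimitive → χ.IsQuadratic → (k = (p + 1) / 4 ∨ k = (3 * p - 1) / 4) →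
      2 ≤ k → k ≤ p - 2 → χ (-1) * (-1) ^ k = -1 →
      ¬ ‖((p - k : ℕ) : ℚ_[p])⁻¹ * generalizedBernoulli (p - k) χ‖ ≤ (p : ℝ)⁻¹ →
      ∃ (K₀ : Type) (_ : Field K₀) (_ : NumberField K₀) (ε₀ : DirichletCharacter ℚ_[p] (NumberField.discr K₀).natAbs),
        IsImaginaryQuadratic K₀ ∧
        (∀ q : ℕ, q.Prime → q ∣ m → ((Ideal.span {(q : ℤ)}).primesOver (𝓞 K₀)).ncard = 2) ∧
        Odd (NumberField.discr K₀) ∧ NumberField.discr K₀ < -4 ∧ IsKroneckerCharacterOf K₀ ε₀ ∧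
        ¬ ‖(k : ℚ_[p])⁻¹ * @generalizedBernoulli ℚ_[p] _ _
            (changeLevel (dvd_mul_right m (NumberField.discr K₀).natAbs) χ *
              changeLevel (dvd_mul_left (NumberField.discr K₀).natAbs m) ε₀).conductor ⟨conductor_ne_zero _⟩ k
            (changeLevel (dvd_mul_right m (NumberField.discr K₀).natAbs) χ *
              changeLevel (dvd_mul_left (NumberField.discr K₀).natAbs m) ε₀).primitiveCharacter‖ ≤ (p : ℝ)⁻¹ := by
  intro p hpF m _ χ k hp6 hmp hχ hχq hk hk2 hkp hpar hcls
  obtain ⟨s, hsne, χ', hs4, hsq, hsp, hsplit, hχ', hunit⟩ := hTw p m χ k hp6 hmp hχ hχq hk hk2 hkp hpar hcls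
  haveI := hsne
  have hp3 : p % 4 = 3 := by rcases hp6 with h | h | h | h | h | h <;> subst h <;> norm_num
  have h7 : 7 ≤ p := by rcases hp6 with h | h | h | h | h | h <;> omega
  exact seed_of_ramifiedTwist hp3 h7 hmp χ hχ hk hs4 hsq hsp hsplit χ' hχ' hunit

/-! ## §4 The class's own datum is the `s = 1` twist: ON the locus, regularity IS (TwistReg) -/

/-- **ON the locus the class is its own twist partner (`s = 1`).** For a class datum ON `L(m,p)` with unit class factor, the pair
`s = 1`, `χ' := χ` (at level `m·1`) satisfies every clause of (TwistReg⁶) — so `seed_of_ramifiedTwist` at `s = 1` is w8 g5's `seedOn_six`,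
and (TwistReg⁶) restricted to the locus is FREE. [cite: Washington1997, Thm. 5.11] -/
theorem twistRegular_one_of_locus {m : ℕ} [NeZero m] (χ : DirichletCharacter ℚ_[p] m) {k : ℕ}
    (hL : (∀ q : ℕ, q.Prime → q ∣ m → q ≠ 2 → jacobiSym (-(p : ℤ)) q = 1) ∧ (2 ∣ m → p % 8 = 7))
    (hcls : ¬ ‖((p - k : ℕ) : ℚ_[p])⁻¹ * generalizedBernoulli (p - k) χ‖ ≤ (p : ℝ)⁻¹) :
    ∃ (s : ℕ) (_ : NeZero s) (χ' : DirichletCharacter ℚ_[p] (m * s)),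
      s % 4 = 1 ∧ Squarefree s ∧ s.Coprime p ∧
      ((∀ q : ℕ, q.Prime → q ∣ m → q ≠ 2 → jacobiSym (-((p * s : ℕ) : ℤ)) q = 1) ∧ (2 ∣ m → (p * s) % 8 = 7)) ∧
      (∀ a : ℕ, χ' (a : ZMod (m * s)) = χ (a : ZMod m) * (J((a : ℤ) | s) : ℚ_[p])) ∧
      ¬ ‖((p - k : ℕ) : ℚ_[p])⁻¹ * generalizedBernoulli (p - k) χ'‖ ≤ (p : ℝ)⁻¹ := by
  refine ⟨1, inferInstance, changeLevel (dvd_mul_right m 1) χ, by norm_num, squarefree_one, Nat.coprime_one_left p, ?_, ?_, ?_⟩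
  · refine ⟨fun q hq hqm hq2 => ?_, fun h2 => ?_⟩
    · simpa using hL.1 q hq hqm hq2
    · simpa using hL.2 h2
  · intro a
    have hI : ((a : ℤ) : ZMod (m * 1)) = (a : ZMod (m * 1)) := by push_cast; rfl
    by_cases ha : a.Coprime (m * 1)
    · have hu : IsCoprime (a : ℤ) ((m * 1 : ℕ) : ℤ) := Nat.isCoprime_iff_coprime.mpr ha
      rw [← hI, changeLevel_eq_cast_of_dvd' _ _ hu, Int.cast_natCast, jacobiSym.one_right, Int.cast_one, mul_one]
    · have hnu : ¬ IsUnit (a : ZMod (m * 1)) := by rwa [ZMod.isUnit_iff_coprime]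
      have hnu' : ¬ IsUnit (a : ZMod m) := by rw [ZMod.isUnit_iff_coprime]; simpa using ha
      rw [MulChar.map_nonunit _ hnu, MulChar.map_nonunit _ hnu', zero_mul]
  · have hB : generalizedBernoulli (p - k) (changeLevel (dvd_mul_right m 1) χ) = generalizedBernoulli (p - k) χ := by
      refine generalizedBernoulli_eq_of_forall_apply_natCast_eq (mul_one m) _ _ (fun a => ?_) (p - k)
      have hI : ((a : ℤ) : ZMod (m * 1)) = (a : ZMod (m * 1)) := by push_cast; rfl
      by_cases ha : a.Coprime (m * 1)
      · have hu : IsCoprime (a : ℤ) ((m * 1 : ℕ) : ℤ) := Nat.isCoprime_iff_coprime.mpr ha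
        rw [← hI, changeLevel_eq_cast_of_dvd' _ _ hu, Int.cast_natCast]
      · have hnu : ¬ IsUnit (a : ZMod (m * 1)) := by rwa [ZMod.isUnit_iff_coprime]
        have hnu' : ¬ IsUnit (a : ZMod m) := by rw [ZMod.isUnit_iff_coprime]; simpa using ha
        rw [MulChar.map_nonunit _ hnu, MulChar.map_nonunit _ hnu']
    rwa [hB]

/-! ## §5 Stub C VERBATIM ⟸ (AtP⁶) ∧ (TwistReg⁶) -/

/-- **Stub C VERBATIM ⟸ (AtP⁶) ∧ (TwistReg⁶)**: LEAD g12's `stubC_of_atP_of_seedOn_of_seedOff` (p681058) with `hOn` discharged by w8 g5's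
`seedOn_six` (p681991) and `hOff` by `seedOff_six_of_twistRegular`. So, granting the print-derivable propagation at `p` (AtP⁶), registry
v19's Stub C / v21's `stub_seedOff` reduce to ONE horizontal statement in class-factor currency: every Eisenstein-regular class off the
locus has an Eisenstein-regular `p`-ramified real-twist partner in its `K₀`-split progression. BSD is not proved by any of this; Stub C is
NOT claimed proved. [cite: KrizLi2019, Thm. 1.20 (p. 8) and §8 (pp. 49–52)] [cite: AhlgrenBoylan2003, Thm. 3] [cite: Washington1997, Thm. 5.11] -/
theorem stubC_of_atP_of_twistRegular
    (hAt : ∀ (p : ℕ) [Fact p.Prime] (m : ℕ) [NeZero m] (χ : DirichletCharacter ℚ_[p] m) (k : ℕ),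
      (p = 7 ∨ p = 11 ∨ p = 19 ∨ p = 43 ∨ p = 67 ∨ p = 163) →
      m.Coprime p → χ.IsPrimitive → χ.IsQuadratic → (k = (p + 1) / 4 ∨ k = (3 * p - 1) / 4) →
      2 ≤ k → k ≤ p - 2 → χ (-1) * (-1) ^ k = -1 →
      (∃ (K₀ : Type) (_ : Field K₀) (_ : NumberField K₀) (ε₀ : DirichletCharacter ℚ_[p] (NumberField.discr K₀).natAbs),
        IsImaginaryQuadratic K₀ ∧
        (∀ q : ℕ, q.Prime → q ∣ m → ((Ideal.span {(q : ℤ)}).primesOver (𝓞 K₀)).ncard = 2) ∧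
        Odd (NumberField.discr K₀) ∧ NumberField.discr K₀ < -4 ∧ IsKroneckerCharacterOf K₀ ε₀ ∧
        ¬ ‖(k : ℚ_[p])⁻¹ * @generalizedBernoulli ℚ_[p] _ _
            (changeLevel (dvd_mul_right m (NumberField.discr K₀).natAbs) χ *
              changeLevel (dvd_mul_left (NumberField.discr K₀).natAbs m) ε₀).conductor ⟨conductor_ne_zero _⟩ k
            (changeLevel (dvd_mul_right m (NumberField.discr K₀).natAbs) χ *
              changeLevel (dvd_mul_left (NumberField.discr K₀).natAbs m) ε₀).primitiveCharacter‖ ≤ (p : ℝ)⁻¹) →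
      ∃ (K : Type) (_ : Field K) (_ : NumberField K) (εK : DirichletCharacter ℚ_[p] (NumberField.discr K).natAbs),
        IsImaginaryQuadratic K ∧
        (∀ q : ℕ, q.Prime → q ∣ p * m → ((Ideal.span {(q : ℤ)}).primesOver (𝓞 K)).ncard = 2) ∧
        Odd (NumberField.discr K) ∧ NumberField.discr K < -4 ∧ IsKroneckerCharacterOf K εK ∧
        ¬ ‖(k : ℚ_[p])⁻¹ * @generalizedBernoulli ℚ_[p] _ _
            (changeLevel (dvd_mul_right m (NumberField.discr K).natAbs) χ *
              changeLevel (dvd_mul_left (NumberField.discr K).natAbs m) εK).conductor ⟨conductor_ne_zero _⟩ k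
            (changeLevel (dvd_mul_right m (NumberField.discr K).natAbs) χ *
              changeLevel (dvd_mul_left (NumberField.discr K).natAbs m) εK).primitiveCharacter‖ ≤ (p : ℝ)⁻¹)
    (hTw : ∀ (p : ℕ) [Fact p.Prime] (m : ℕ) [NeZero m] (χ : DirichletCharacter ℚ_[p] m) (k : ℕ),
      (p = 7 ∨ p = 11 ∨ p = 19 ∨ p = 43 ∨ p = 67 ∨ p = 163) →
      m.Coprime p → χ.IsPrimitive → χ.IsQuadratic → (k = (p + 1) / 4 ∨ k = (3 * p - 1) / 4) →
      2 ≤ k → k ≤ p - 2 → χ (-1) * (-1) ^ k = -1 →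
      ¬ ((∀ q : ℕ, q.Prime → q ∣ m → q ≠ 2 → jacobiSym (-(p : ℤ)) q = 1) ∧ (2 ∣ m → p % 8 = 7)) →
      ¬ ‖((p - k : ℕ) : ℚ_[p])⁻¹ * generalizedBernoulli (p - k) χ‖ ≤ (p : ℝ)⁻¹ →
      ∃ (s : ℕ) (_ : NeZero s) (χ' : DirichletCharacter ℚ_[p] (m * s)),
        s % 4 = 1 ∧ Squarefree s ∧ s.Coprime p ∧
        ((∀ q : ℕ, q.Prime → q ∣ m → q ≠ 2 → jacobiSym (-((p * s : ℕ) : ℤ)) q = 1) ∧ (2 ∣ m → (p * s) % 8 = 7)) ∧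
        (∀ a : ℕ, χ' (a : ZMod (m * s)) = χ (a : ZMod m) * (J((a : ℤ) | s) : ℚ_[p])) ∧
        ¬ ‖((p - k : ℕ) : ℚ_[p])⁻¹ * generalizedBernoulli (p - k) χ'‖ ≤ (p : ℝ)⁻¹) :
    ∀ (W : WeierstrassCurve ℚ) [W.IsElliptic] [W.IsGloballyMinimal] (p : ℕ) [Fact p.Prime], W.HasCM → CMRamified W p → 5 ≤ p →
      W.analyticRank = 1 → ∀ (f : ℕ) [NeZero f] (ψ : DirichletCharacter ℚ_[p] f) (ω : DirichletCharacter ℚ_[p] p), ψ.Odd →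
      IsTeichmullerCharacter ω →
      (∀ ℓ : ℕ, ℓ.Prime → ¬ (ℓ ∣ p * W.conductorNorm ℤ) →
        ‖((W.LFunction ℓ : ℤ) : ℚ_[p]) - (ψ (ℓ : ZMod f) + ψ⁻¹ (ℓ : ZMod f) * ω (ℓ : ZMod p))‖ < 1) →
      ¬ ‖bernoulliOnePrim ψ⁻¹‖ ≤ (p : ℝ)⁻¹ →
      ∃ (K : Type) (_ : Field K) (_ : NumberField K) (εK : DirichletCharacter ℚ_[p] (NumberField.discr K).natAbs),
        IsImaginaryQuadratic K ∧ SatisfiesHeegnerHypothesis (W.conductorNorm ℤ) K ∧ Odd (NumberField.discr K) ∧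
        NumberField.discr K < -4 ∧ IsKroneckerCharacterOf K εK ∧
        ¬ ‖bernoulliOnePrim (bernoulliCharTwo ψ εK ω)‖ ≤ (p : ℝ)⁻¹ :=
  stubC_of_atP_of_seedOn_of_seedOff hAt seedOn_six (seedOff_six_of_twistRegular hTw)

end Summit.BirchSwinnertonDyer.BirchSwinnertonDyer.Theorems.PrintCFram.HeegnerFieldSupply

end
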